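import Summits.BirchSwinnertonDyer.BirchSwinnertonDyer.Theorems.BiquadraticEisensteinDescentHeegnerTwistCouplingInSupplyPartnerLadder
import Summits.BirchSwinnertonDyer.BirchSwinnertonDyer.Theorems.BiquadraticEisensteinDescentHeegnerTwistCouplingInSupplyQuarticMinusTripleCorner
import HarnessLib

set_option linter.dupNamespace false -- `Summit.BirchSwinnertonDyer.BirchSwinnertonDyer.Theorems.…` (summit = sub, D-0017)
set_option autoImplicit false

/-!
# Crux `HeegnerTwistCouplingInSupply` (stmt-BirchSwinnertonDyer-21381), card `class-number-switch-duke-bilinear` —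
# KERNEL PARTNER TABLE for the `E_p` MISSING CELL below `2000`: an explicit `(3,+)`/`(5,−)` pair for every prime
# `p ≡ 7 (mod 24)`, `p ≡ ±1 (mod 5)`, `p < 2000`, hence the whole `E_p` corner below `2000` modulo the five named facts

Route `BiquadraticEisensteinDescent` (cell `pub/bsd-wall`; width seat `bsd-wall-cm-bed-w4` g25; theorems only,
`--supports 21381`). Companion of `…DukeBilinearCorner.lean` (Case A of the card needs a `(3,+)` prime `ℓ₃` of size
`p^{1−δ}` — the Duke shrinking-disc supply — for LARGE `p`) and of the line lead's `…PartnerTables.lean` /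
`…IndefinitePinCorner.cruxOnEpCorner_of_facts` (every prime `p ≡ 7 (mod 8)` with `p ≡ 2 (mod 3)` or `p ≡ ±2 (mod 5)`):
below `2000` the missing cell `p ≡ 1 (mod 3)`, `p ≡ ±1 (mod 5)` — twenty primes, `31, 79, 151, …, 1999` — is closed by TABLE.

* §1 `tableMissingCell` (kernel, ONE `decide +kernel`) — for each such `p` one of eleven pairs `(ℓ₃, ℓ₅)`,
  `ℓ₃ ∈ {11, 19, 43, 59}` (`≡ 3 (mod 8)`), `ℓ₅ ∈ {13, 29, 37, 53}` (`≡ 5 (mod 8)`), has `p` a non-residue mod `ℓ₃` and mod `ℓ₅`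
  (so `(ℓ₃/p) = +1`, `(ℓ₅/p) = −1`) and `h(−ℓ₃ℓ₅) < p` (Cohen's reduced-form count `BinQF.classNumberCount`, `|d| ≤ 1591`,
  `h ≤ 30`). Rows `(p; ℓ₃, ℓ₅; h)`: `(31; 19,13; 6) (79; 11,29; 10) (151; 11,13; 10) (199; 43,37; 22) (271; 11,13; 10)
  (439; 11,37; 16) (631; 43,13; 16) (751; 19,29; 26) (919; 11,37; 16) (991; 19,37; 14) (1039; 19,53; 30) (1231; 11,53; 8)
  (1279; 43,13; 16) (1399; 11,13; 10) (1471; 11,13; 10) (1759; 11,29; 10) (1831; 59,13; 22) (1879; 43,13; 16) (1951; 19,29; 26)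
  (1999; 11,29; 10)`.
* §2 ★ `cruxConclusion_of_pair` — the universal cell `{(3,+),(5,−)}` at one `p ≡ 7 (mod 8)` with an explicit pair and any
  certificate `h(ℚ(√−ℓ₃ℓ₅)) < p` ⟹ the crux's conclusion at `(E_p, p)` (modulo the five named facts);
  ★ `cruxOnEpCornerMissingCell_of_facts_lt` — the missing cell for `p < 2000`.
* §3 ★ `cruxOnEpCorner_of_facts_lt` — the WHOLE corner `W = E_p`: every prime `p ≡ 7 (mod 8)`, `p < 2000`, modulo Modularity,
  Monsky (odd), Burungale–Tian, Deuring–Hecke, Burungale–Flach (the tree's `cruxOnEpCorner_of_facts` ∪ §2).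

HONEST FRAMING: a finite table; above `2000` the missing cell is the card's Case A/B (`…DukeBilinearSwitch.firstLemma`, conditional
on the two supplies). Nothing here proves the crux or BSD. No definition, no named fact, no `sorry`; axioms standard.
[cite: HeathBrown1994SelmerCongruentII, Appendix (Monsky), typescript p. 39 L27–L33] [cite: Cohen1993, §5.3.1 Algorithm 5.3.5]
[cite: Cox2013, §2.A Thm. 2.13] [cite: BurungaleTian2026, Thm. 1.1] [cite: BurungaleFlach2024, Thm. 1.1 and Cor. 2]
-/

namespace Summit.BirchSwinnertonDyer.BirchSwinnertonDyer.Theorems.DukeBilinearCells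

open Literature.NumberTheory.EllipticCurves Literature.NumberTheory.EllipticCurves.HeathBrown1994
  Literature.NumberTheory.EllipticCurves.HeathBrown1994.Families
  Literature.NumberTheory.QuadraticFields Literature.NumberTheory.QuadraticFields.Quadratic
open Summit.BirchSwinnertonDyer.BirchSwinnertonDyer.Theorems.BiquadraticEisensteinDescentHeegnerTwistCouplingInSupplyMonskyCells
  Summit.BirchSwinnertonDyer.BirchSwinnertonDyer.Theorems.BiquadraticEisensteinDescentHeegnerTwistCouplingInSupplyThreeSquaresPinRankZero
  Summit.BirchSwinnertonDyer.BirchSwinnertonDyer.Theorems.BiquadraticEisensteinDescentHeegnerTwistCouplingInSupplyThreeSquaresPinCorner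
  Summit.BirchSwinnertonDyer.BirchSwinnertonDyer.Theorems.BiquadraticEisensteinDescentHeegnerTwistCouplingInSupplyPartnerTables
  Summit.BirchSwinnertonDyer.BirchSwinnertonDyer.Theorems.BiquadraticEisensteinDescentHeegnerTwistCouplingInSupplyPartnerLadder
  Summit.BirchSwinnertonDyer.BirchSwinnertonDyer.Theorems.BiquadraticEisensteinDescentHeegnerTwistCouplingInSupplyIndefinitePinCorner
  Summit.BirchSwinnertonDyer.BirchSwinnertonDyer.Theorems.BiquadraticEisensteinDescentHeegnerTwistCouplingInSupplyQuarticMinusTripleCorner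

/-! ## §1 The table (kernel) -/

/-- The eleven partner pairs `(ℓ₃, ℓ₅)`: `ℓ₃` prime `≡ 3 (mod 8)`, `ℓ₅` prime `≡ 5 (mod 8)`. [folklore] -/
theorem partnerPairs_spec : ∀ q ∈ [(11, 13), (11, 29), (11, 37), (11, 53), (19, 13), (19, 29), (19, 37), (19, 53),
      (43, 13), (43, 37), (59, 13)],
    (q : ℕ × ℕ).1.Prime ∧ q.1 % 8 = 3 ∧ q.2.Prime ∧ q.2 % 8 = 5 := by
  decide +kernel

/-- **Table of the missing cell (kernel).** For every prime `p ≡ 7 (mod 24)`, `p ≡ ±1 (mod 5)`, `p < 2000`: one of the eleven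
pairs `(ℓ₃, ℓ₅)` has `p` a NON-residue mod `ℓ₃` and mod `ℓ₅` and `h(−ℓ₃ℓ₅) < p` (Cohen's count of reduced forms of
discriminant `−ℓ₃ℓ₅`). Twenty rows, listed in the module docstring. [cite: Cohen1993, §5.3.1 Algorithm 5.3.5] [cite: Cox2013, §2.A Thm. 2.13] -/
theorem tableMissingCell : ∀ p ∈ Finset.range 2000, p % 24 = 7 → (p % 5 = 1 ∨ p % 5 = 4) → p.Prime →
    ∃ q ∈ [(11, 13), (11, 29), (11, 37), (11, 53), (19, 13), (19, 29), (19, 37), (19, 53), (43, 13), (43, 37), (59, 13)],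
      (∀ x < (q : ℕ × ℕ).1, x * x % q.1 ≠ p % q.1) ∧ (∀ x < q.2, x * x % q.2 ≠ p % q.2) ∧
        BinQF.classNumberCount (q.1 * q.2) < p := by
  decide +kernel

/-! ## §2 The universal cell at an explicit pair -/

/-- ★ **The universal cell `{(3,+),(5,−)}` at an explicit pair.** For a prime `p ≡ 7 (mod 8)`, primes `ℓ₃ ≡ 3`, `ℓ₅ ≡ 5 (mod 8)`
with `(ℓ₃/p) = +1`, `(ℓ₅/p) = −1`, and any certificate `h(·) < p` for the imaginary quadratic fields of discriminant `−ℓ₃ℓ₅`,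
modulo the five named facts: the conclusion of `HeegnerTwistCouplingInSupply` at `(E_p, p)` with `K′ = ℚ(√−ℓ₃ℓ₅)`
(`det M(p, ℓ₃, ℓ₅) = 1` by `det_monskyMatrixOdd_cell_seven_mod_eight`, Heegner for `N(E_p) = 32p²`).
[cite: HeathBrown1994SelmerCongruentII, Appendix (Monsky), typescript p. 39 L27–L33] [cite: BurungaleTian2026, Thm. 1.1]
[cite: BurungaleFlach2024, Thm. 1.1 and Cor. 2] [cite: KoblitzECMF1993, Ch. II §5, Theorem (p. 84)] -/
theorem cruxConclusion_of_pair (hmod : ModularForms.exists_isNewformOf) (hM : monsky_card_selmerGroup_two_odd)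
    (hBT : burungaleTian_analyticRank_eq_zero_of_selmerCorank_eq_zero_of_hasCM)
    (hH : hasEntireLFunction_of_j_mem_maximalCMJInvariants) (hBF : bsdTriple_of_hasCM_of_L_one_ne_zero)
    (p : ℕ) [Fact p.Prime] [(congruentNumberCurve p).IsElliptic] [(congruentNumberCurve p).IsGloballyMinimal]
    [NeZero ((congruentNumberCurve p).conductorNorm ℤ)] (hp8 : p % 8 = 7)
    {ℓ₃ ℓ₅ : ℕ} (h₃ : ℓ₃.Prime) (h38 : ℓ₃ % 8 = 3) (h₅ : ℓ₅.Prime) (h58 : ℓ₅ % 8 = 5)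
    (h3p : jacobiSym (ℓ₃ : ℤ) p = 1) (h5p : jacobiSym (ℓ₅ : ℤ) p = -1)
    (hh : ∀ (K : Type) [Field K] [NumberField K], IsImaginaryQuadratic K →
      NumberField.discr K = -((ℓ₃ * ℓ₅ : ℕ) : ℤ) → NumberField.classNumber K < p) :
    ∃ (K : Type) (_ : Field K) (_ : NumberField K),
      IsImaginaryQuadratic K ∧ 4 < (NumberField.discr K).natAbs ∧
      SatisfiesHeegnerHypothesis ((congruentNumberCurve p).conductorNorm ℤ) K ∧
      ((congruentNumberCurve p).quadraticTwist (NumberField.discr K : ℚ)).entireLFunction 1 ≠ 0 ∧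
      NumberField.classNumber K < p ∧ ¬ p ∣ NumberField.classNumber K := by
  have hp : p.Prime := Fact.out
  have hp4 : p % 4 = 3 := by omega
  have hdet := det_monskyMatrixOdd_cell_seven_mod_eight hp h₃ h₅ hp8 h38 h58 h5p
  have hp3 : p ≠ ℓ₃ := by rintro rfl; omega
  have hp5 : p ≠ ℓ₅ := by rintro rfl; omega
  have h35 : ℓ₃ ≠ ℓ₅ := by rintro rfl; omega
  obtain ⟨-, -, -, hL⟩ := analyticRank_eq_zero_of_det_odd hM hBT hH hBF hp h₃ h₅ (by omega) (by omega) (by omega)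
    hp3 hp5 h35 hdet
  have hN : (congruentNumberCurve p).conductorNorm ℤ = 32 * p ^ 2 :=
    conductorNorm_congruentNumberCurve_of_odd hmod hp.squarefree (Nat.odd_iff.mpr (by omega))
  have h15 : 15 ≤ ℓ₃ * ℓ₅ := by
    have h3' : 3 ≤ ℓ₃ := by have := h₃.two_le; omega
    have h5' : 5 ≤ ℓ₅ := by have := h₅.two_le; omega
    exact le_trans (by norm_num) (Nat.mul_le_mul h3' h5')
  -- `(−ℓ₃ℓ₅/p) = (−1/p)(ℓ₃/p)(ℓ₅/p) = (−1)(+1)(−1) = +1` (cf. `…DukeBilinearCorner.jacobiSym_neg_pair_eq_one`)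
  have hJ : jacobiSym (-((ℓ₃ * ℓ₅ : ℕ) : ℤ)) p = 1 := by
    have hm1 : jacobiSym (-1) p = -1 := DeuringLadic.jacobiSym_neg_one_of_mod_four hp4
    have : (-((ℓ₃ * ℓ₅ : ℕ) : ℤ)) = (-1) * (ℓ₃ : ℤ) * (ℓ₅ : ℤ) := by push_cast; ring
    rw [this, jacobiSym.mul_left, jacobiSym.mul_left, hm1, h3p, h5p]
    norm_num
  obtain ⟨K, iF, iN, hK, hdK, hH', hcl⟩ := exists_witnessField_of (N := (congruentNumberCurve p).conductorNorm ℤ)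
    h₃ h38 h₅ h58 hJ hh (fun r hr hrN => eq_two_or_eq_of_prime_dvd_thirtyTwo_mul_sq hp hr (hN ▸ hrN))
  refine ⟨K, iF, iN, hK, ?_, hH', ?_, hcl, ?_⟩
  · rw [hdK, Int.natAbs_neg, Int.natAbs_natCast]
    omega
  · rw [hdK, quadraticTwist_congruentNumberCurve, Int.natAbs_neg, Int.natAbs_natCast]
    exact hL
  · exact fun hdvd => absurd (Nat.le_of_dvd (NumberField.classNumber_pos K) hdvd) (not_le.mpr hcl)

/-- ★ **The missing cell below `2000`.** For every prime `p ≡ 7 (mod 24)`, `p ≡ ±1 (mod 5)` (i.e. `p ≡ 7 (mod 8)`,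
`p ≡ 1 (mod 3)`, `p ≡ ±1 (mod 5)` — the cell left open by `cruxOnEpCorner_of_facts`) with `p < 2000`, modulo the five named
facts: the conclusion of `HeegnerTwistCouplingInSupply` at `(E_p, p)`, by the table pair `(ℓ₃, ℓ₅)` and `K′ = ℚ(√−ℓ₃ℓ₅)`,
`h(K′) < p`. [cite: HeathBrown1994SelmerCongruentII, Appendix (Monsky), typescript p. 39 L27–L33] [cite: Cox2013, §2.A Thm. 2.13]
[cite: BurungaleTian2026, Thm. 1.1] [cite: BurungaleFlach2024, Thm. 1.1 and Cor. 2] -/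
theorem cruxOnEpCornerMissingCell_of_facts_lt (hmod : ModularForms.exists_isNewformOf)
    (hM : monsky_card_selmerGroup_two_odd)
    (hBT : burungaleTian_analyticRank_eq_zero_of_selmerCorank_eq_zero_of_hasCM)
    (hH : hasEntireLFunction_of_j_mem_maximalCMJInvariants) (hBF : bsdTriple_of_hasCM_of_L_one_ne_zero) :
    ∀ (p : ℕ) [Fact p.Prime] [(congruentNumberCurve p).IsElliptic]
      [(congruentNumberCurve p).IsGloballyMinimal] [NeZero ((congruentNumberCurve p).conductorNorm ℤ)],
      p % 24 = 7 → (p % 5 = 1 ∨ p % 5 = 4) → p < 2000 →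
      ∃ (K : Type) (_ : Field K) (_ : NumberField K),
        IsImaginaryQuadratic K ∧ 4 < (NumberField.discr K).natAbs ∧
        SatisfiesHeegnerHypothesis ((congruentNumberCurve p).conductorNorm ℤ) K ∧
        ((congruentNumberCurve p).quadraticTwist (NumberField.discr K : ℚ)).entireLFunction 1 ≠ 0 ∧
        NumberField.classNumber K < p ∧ ¬ p ∣ NumberField.classNumber K := by
  intro p hpF _ _ _ hp24 hp5 hlt
  have hp : p.Prime := hpF.out
  have hp4 : p % 4 = 3 := by omega
  obtain ⟨q, hq, hres3, hres5, hh⟩ := tableMissingCell p (Finset.mem_range.mpr hlt) hp24 hp5 hp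
  obtain ⟨h₃, h38, h₅, h58⟩ := partnerPairs_spec q hq
  have h3p : jacobiSym (q.1 : ℤ) p = 1 := jacobiSym_eq_one_of_table h₃ hp4 h38 hres3
  have h5p : jacobiSym (q.2 : ℤ) p = -1 := by
    rw [jacobiSym.quadratic_reciprocity_one_mod_four (by omega) (Nat.odd_iff.mpr (by omega))]
    exact jacobiSym_eq_neg_one_of_forall_sq_ne h₅ hres5
  have hpos : 0 < q.1 * q.2 := Nat.mul_pos h₃.pos h₅.pos
  exact cruxConclusion_of_pair hmod hM hBT hH hBF p (by omega) h₃ h38 h₅ h58 h3p h5p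
    (classNumber_lt_of_count_triple hpos hh)

/-! ## §3 The whole `E_p` corner below `2000` -/

/-- ★ **Corner `W = E_p`, EVERY prime `p ≡ 7 (mod 8)` below `2000`** — modulo Modularity, Monsky (odd), Burungale–Tian,
Deuring–Hecke and Burungale–Flach (hypotheses by name): a Heegner field `K′` of `N(E_p)` with `|d_{K′}| > 4`,
`L(E_p^{(d_{K′})}, 1) ≠ 0`, `h(K′) < p` and `p ∤ h(K′)`. Cells: `p ≡ 2 (mod 3)` or `p ≡ ±2 (mod 5)` by the tree's
`cruxOnEpCorner_of_facts` (all `p`); the missing cell `p ≡ 1 (mod 3)`, `p ≡ ±1 (mod 5)` by the table (`p < 2000`; beyond, see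
`…DukeBilinearSwitch.firstLemma`, conditional on the card's two supplies). [cite: HeathBrown1994SelmerCongruentII, Appendix (Monsky), typescript p. 39 L27–L33]
[cite: Cox2013, §2.A Thm. 2.13] [cite: BurungaleTian2026, Thm. 1.1] [cite: BurungaleFlach2024, Thm. 1.1 and Cor. 2] -/
theorem cruxOnEpCorner_of_facts_lt (hmod : ModularForms.exists_isNewformOf) (hM : monsky_card_selmerGroup_two_odd)
    (hBT : burungaleTian_analyticRank_eq_zero_of_selmerCorank_eq_zero_of_hasCM)
    (hH : hasEntireLFunction_of_j_mem_maximalCMJInvariants) (hBF : bsdTriple_of_hasCM_of_L_one_ne_zero) :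
    ∀ (p : ℕ) [Fact p.Prime] [(congruentNumberCurve p).IsElliptic]
      [(congruentNumberCurve p).IsGloballyMinimal] [NeZero ((congruentNumberCurve p).conductorNorm ℤ)],
      p % 8 = 7 → p < 2000 →
      ∃ (K : Type) (_ : Field K) (_ : NumberField K),
        IsImaginaryQuadratic K ∧ 4 < (NumberField.discr K).natAbs ∧
        SatisfiesHeegnerHypothesis ((congruentNumberCurve p).conductorNorm ℤ) K ∧
        ((congruentNumberCurve p).quadraticTwist (NumberField.discr K : ℚ)).entireLFunction 1 ≠ 0 ∧
        NumberField.classNumber K < p ∧ ¬ p ∣ NumberField.classNumber K := by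
  intro p hpF _ _ _ hp8 hlt
  have hp : p.Prime := hpF.out
  by_cases hcase : p % 3 = 2 ∨ p % 5 = 2 ∨ p % 5 = 3
  · exact cruxOnEpCorner_of_facts hmod hM hBT hH hBF p hp8 hcase
  · -- `p ≡ 1 (mod 3)` (not `0`: `p ≠ 3`) and `p ≡ ±1 (mod 5)` (not `0`: `p ≠ 5`)
    have hp3 : p % 3 ≠ 0 := by
      intro h
      have := (Nat.prime_dvd_prime_iff_eq Nat.prime_three hp).mp (Nat.dvd_of_mod_eq_zero h)
      omega
    have hp5 : p % 5 ≠ 0 := by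
      intro h
      have := (Nat.prime_dvd_prime_iff_eq Nat.prime_five hp).mp (Nat.dvd_of_mod_eq_zero h)
      omega
    exact cruxOnEpCornerMissingCell_of_facts_lt hmod hM hBT hH hBF p (by omega) (by omega) hlt

end Summit.BirchSwinnertonDyer.BirchSwinnertonDyer.Theorems.DukeBilinearCells
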